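import Summits.QuantumFields.BalabanUV.Beta.TubeZeroFree

/-!
# Beta / TubeZeroFreeFins — THEOREM DB's winding datum (W) BY DEFORMATION TO THE REAL TORUS: `SliceWindingEq` at a reference parameter
# follows from zero-freeness on two 2-real-dimensional FINS; THEOREM DB with (W) := fins
# (β sub-cell, BINDER-OWNERS row CAP-k, lineage `b2b-balaban-beta-an5`, gen 25; node BETA-an5-g25-FINS, leaf 1 of 2; journal CLAIM l.16546)

THE PROBLEM.  THEOREM DB (`TubeZeroFree`: `TubeHol.ne_zero_of_vertexTori`, `MatTubeHol.det_ne_zero_of_vertexTori`) reduces the (Z1) binder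
`hdet : ∀ p ∈ Strip (d+1) a, (A p).det ≠ 0` to (F) zero-freeness on the vertex tori — FREE from the (Z2a) box leaves
(`TubeZeroFreeSymmetry.det_ne_zero_vertexTori_of_boxes_negConjRegion`) — plus (W) one `SliceWindingEq` per coordinate and sign pattern
(4 for the cell's reflection-invariant `det k₀`, `CapRouteABoxesReflect`), each (W) certified by two closed compass words
(`TubeZeroFreeEnds.sliceWindingEq_of_words`): validated arguments of a `744`-dimensional determinant along a line — a SEPARATE engine code
path, to be written twice (census CAPK-CENSUS-g24 V22).  THIS LEAF REMOVES THE WORDS: the two boundary loops `x ↦ G(x·e_i ± i·w_i·e_i + q₀)` of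
the slice at a tube parameter `q₀` BOTH deform — shrinking ALL imaginary parts by a factor `τ ∈ [0, 1]` — to the SAME loop
`x ↦ G(x·e_i + Re q₀)` at `τ = 0`; if `G` has no zero on the two FINS swept out (`{x·e_i ± iτ·w_i·e_i + Re q₀ + iτ·Im q₀ : x ∈ [−π, π],
τ ∈ [0, 1]}`, 2 real dimensions each), the three loops have equal windings (`LoopIncrement.incr_eq_of_family`: the increment of a continuous
logarithm is constant through a jointly continuous family of closed zero-free loops), i.e. `SliceWindingEq G w i q₀` holds — with NO winding
number computed.  A fin is certified by box leaves of the SAME resolvent-certificate type as (Z2a) (`IsUnit (A p).det` on a rectangle in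
`(x, τ)`; companion leaf `ResolventFinCertificate`).  No `def` is introduced (kernel lane): the fin point at `(τ, x)` with slope `σ` through `q`
is written out as `insertNth i (x + iτσ) (Re q + iτ·Im q)`.

* §1 fin points: tube membership, joint continuity, closed loops (periodicity), the `τ = 1` ∕ `τ = 0` ends.
* §2 **`SliceWindingEq.of_fins`** — (W) at `(i, q₀)` from `G ≠ 0` on the two fins (`σ = ±w_i`) through `q₀`.
* §3 THEOREM DB WITH FINS: `windingHyp_of_fins` (= the (W) hypothesis `hW` of `CapRouteABoxes.rowsOfOneLoopFormCode16E_routeA₂_ofBoxesRealShift` ∕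
  `MatTubeHol.det_ne_zero_of_vertexTori` AS DATA, from the `(d+1)·2^{d+1}` fins through the purely imaginary reference parameters `i·s∘w`),
  `TubeHol.ne_zero_of_vertexTori_of_fins`, `MatTubeHol.det_ne_zero_of_vertexTori_of_fins` (the (Z1) binder `hdet` BY NAME).
* §4 REFLECTION-INVARIANT multipliers (the cell's `det k₀` on engines D∕E, census V22): the lower fin is the reflection of the upper one read at
  `−x`, so `d + 1` ALL-PLUS fins `{x·e_i + iτ·w : x ∈ [−π, π], τ ∈ [0, 1]}` suffice — `sliceWindingEq_allPlus_of_fin` (= the hypothesis `hW4 i`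
  of `CapRouteABoxesReflect.rowsOfOneLoopFormCode16E_routeA₂_ofBoxesRealShift_ofReflect` AS DATA), `TubeHol.ne_zero_of_vertexTori_of_reflect_of_fins`,
  `MatTubeHol.det_ne_zero_of_vertexTori_of_reflect_of_fins`.

CONSEQUENCE FOR THE ROW (census v1.6 V27): after this leaf EVERY numerical binder of the row's anchor except (T) `hT`, (N) `hb` and the (Z2b) stencil
sups is a box leaf of ONE certificate type — (Z2a)+(F) on the quarter region of the vertex tori (4 real dimensions) and (W) on 4 fin rectangles
`[−π, π] × [0, 1]` (2 real dimensions; interior-diagonal points `Im p = τκ·(1,1,1,1)`, `τ ≤ 1`).  No fin certificate exists; none is claimed.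

HONEST FRAMING.  Kernel complex analysis ([folklore] homotopy invariance of the winding number, over the tree's `WindingIncrement` ∕
`LoopIncrement`); no number, no binder INSTANCE for the cell's `k₀`.  Discharging `BetaPertH` would make Bałaban's ultraviolet stability
unconditional — NOT the continuum limit, NOT the Clay problem.  0 `sorry`, 0 cite tags.
-/

namespace Summit.QuantumFields.BalabanUV.Beta.TubeMaximumModulus

open Complex Set Metric Filter Topology
open Literature.MathematicalPhysics.QuantumFieldTheory.Balaban1983to89
open B4Strip (Strip)
open Summit.QuantumFields.BalabanUV.Beta.WindingIncrement
open Summit.QuantumFields.BalabanUV.Beta.LoopIncrement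
open Summit.QuantumFields.BalabanUV.Beta.VertexToriSymmetry (reflectAt reflectAt_apply_same reflectAt_apply_ne reflectAt_reflectAt)
open scoped Real

noncomputable section

variable {d : ℕ} {G : (Fin (d + 1) → ℂ) → ℂ} {w : Fin (d + 1) → ℝ}

/-! ## §1 Fin points: `insertNth i (x + iτσ) (Re q + iτ·Im q)` -/

/-- shrinking the imaginary parts of a tube parameter by `τ ∈ [0, 1]` keeps it in the tube. [folklore] -/
theorem shrink_mem_tube {w' : Fin d → ℝ} {q : Fin d → ℂ} (hq : q ∈ Tube w') {τ : ℝ} (hτ : τ ∈ Icc (0 : ℝ) 1) :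
    (fun j => (((q j).re : ℝ) : ℂ) + ((τ * (q j).im : ℝ) : ℂ) * I) ∈ Tube w' := by
  intro j
  have him : ((((q j).re : ℝ) : ℂ) + ((τ * (q j).im : ℝ) : ℂ) * I).im = τ * (q j).im := by simp
  rw [him, abs_mul, abs_of_nonneg hτ.1]
  calc τ * |(q j).im| ≤ 1 * |(q j).im| := mul_le_mul_of_nonneg_right hτ.2 (abs_nonneg _)
    _ ≤ w' j := by rw [one_mul]; exact hq j

/-- at `τ = 1` nothing is shrunk. [folklore] -/
theorem shrink_one (q : Fin d → ℂ) : (fun j => (((q j).re : ℝ) : ℂ) + (((q j).im : ℝ) : ℂ) * I) = q := by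
  funext j; exact Complex.ext (by simp) (by simp)

/-- the fin point map `(τ, x) ↦ insertNth i (x + iτσ) (Re q + iτ·Im q)` is continuous. [folklore] -/
theorem continuous_finPoint (i : Fin (d + 1)) (q : Fin d → ℂ) (σ : ℝ) :
    Continuous fun p : ℝ × ℝ => (i.insertNth ((p.2 : ℂ) + ((p.1 * σ : ℝ) : ℂ) * I)
      (fun j => (((q j).re : ℝ) : ℂ) + ((p.1 * (q j).im : ℝ) : ℂ) * I) : Fin (d + 1) → ℂ) := by
  refine Continuous.finInsertNth i ?_ (continuous_pi fun j => ?_)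
  · exact (continuous_ofReal.comp continuous_snd).add
      ((continuous_ofReal.comp (continuous_fst.mul continuous_const)).mul continuous_const)
  · exact continuous_const.add ((continuous_ofReal.comp (continuous_fst.mul continuous_const)).mul continuous_const)

/-- fin points lie in the tube when `|σ| ≤ w_i`, `τ ∈ [0, 1]` and `q` is a tube parameter. [folklore] -/
theorem finPoint_mem_tube (i : Fin (d + 1)) {q : Fin d → ℂ} (hq : q ∈ Tube (fun j => w (i.succAbove j))) {σ : ℝ}
    (hσ : |σ| ≤ w i) {τ : ℝ} (hτ : τ ∈ Icc (0 : ℝ) 1) (x : ℝ) :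
    (i.insertNth ((x : ℂ) + ((τ * σ : ℝ) : ℂ) * I)
      (fun j => (((q j).re : ℝ) : ℂ) + ((τ * (q j).im : ℝ) : ℂ) * I) : Fin (d + 1) → ℂ) ∈ Tube w := by
  refine insertNth_mem_tube i (shrink_mem_tube hq hτ) ?_
  have him : (((x : ℂ) + ((τ * σ : ℝ) : ℂ) * I)).im = τ * σ := by simp
  rw [him, abs_mul, abs_of_nonneg hτ.1]
  calc τ * |σ| ≤ 1 * |σ| := mul_le_mul_of_nonneg_right hτ.2 (abs_nonneg _)
    _ ≤ w i := by rw [one_mul]; exact hσ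

/-- THE FIN FAMILY of slope `σ` through `q` is jointly continuous on `[0, 1] × [−π, π]` for a tube-holomorphic `G` (`|σ| ≤ w_i`). [folklore] -/
theorem TubeHol.continuousOn_finFamily (h : TubeHol G w) (i : Fin (d + 1)) {q : Fin d → ℂ}
    (hq : q ∈ Tube (fun j => w (i.succAbove j))) {σ : ℝ} (hσ : |σ| ≤ w i) :
    ContinuousOn (fun p : ℝ × ℝ => G (i.insertNth ((p.2 : ℂ) + ((p.1 * σ : ℝ) : ℂ) * I)
      fun j => (((q j).re : ℝ) : ℂ) + ((p.1 * (q j).im : ℝ) : ℂ) * I)) (Icc 0 1 ×ˢ Icc (-π) π) :=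
  h.cont.comp (continuous_finPoint i q σ).continuousOn fun p hp => finPoint_mem_tube i hq hσ hp.1 p.2

/-- the fin family consists of CLOSED loops (periodicity of `G` in coordinate `i`). [folklore] -/
theorem TubeHol.finFamily_closed (h : TubeHol G w) (i : Fin (d + 1)) (q : Fin d → ℂ) (σ τ : ℝ) :
    G (i.insertNth (((π : ℝ) : ℂ) + ((τ * σ : ℝ) : ℂ) * I) fun j => (((q j).re : ℝ) : ℂ) + ((τ * (q j).im : ℝ) : ℂ) * I)
      = G (i.insertNth (((-π : ℝ) : ℂ) + ((τ * σ : ℝ) : ℂ) * I) fun j => (((q j).re : ℝ) : ℂ) + ((τ * (q j).im : ℝ) : ℂ) * I) := by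
  have e := h.periodic_slice i (fun j => (((q j).re : ℝ) : ℂ) + ((τ * (q j).im : ℝ) : ℂ) * I)
    (((-π : ℝ) : ℂ) + ((τ * σ : ℝ) : ℂ) * I)
  rw [show ((-π : ℝ) : ℂ) + ((τ * σ : ℝ) : ℂ) * I + 2 * π = ((π : ℝ) : ℂ) + ((τ * σ : ℝ) : ℂ) * I by push_cast; ring] at e
  exact e

/-! ## §2 (W) from zero-freeness on the two fins -/

/-- **(W) BY DEFORMATION TO THE REAL TORUS.**  For a tube-holomorphic `G`, a coordinate `i` (`0 ≤ w_i`) and a tube parameter `q`: if `G` has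
no zero on the two FINS `{insertNth i (x + iτσ) (Re q + iτ·Im q) : x ∈ [−π, π], τ ∈ [0, 1]}`, `σ = ±w_i`, then the slice of `G` through `q`
has equal windings along `Im z = ±w_i` — `SliceWindingEq G w i q`, THEOREM DB's (W) datum — with NO winding number computed: the boundary loops
(`τ = 1`) and the common real loop `x ↦ G (insertNth i x (Re q))` (`τ = 0`) have equal increments of continuous logarithms by
`LoopIncrement.incr_eq_of_family`. [folklore] -/
theorem SliceWindingEq.of_fins (h : TubeHol G w) (i : Fin (d + 1)) (hwi : 0 ≤ w i) {q : Fin d → ℂ}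
    (hq : q ∈ Tube (fun j => w (i.succAbove j)))
    (hfin : ∀ σ : ℝ, |σ| = w i → ∀ τ ∈ Icc (0 : ℝ) 1, ∀ x ∈ Icc (-π) π,
      G (i.insertNth ((x : ℂ) + ((τ * σ : ℝ) : ℂ) * I) fun j => (((q j).re : ℝ) : ℂ) + ((τ * (q j).im : ℝ) : ℂ) * I) ≠ 0) :
    SliceWindingEq G w i q := by
  -- the fin families as two-parameter functions
  set F : ℝ → ℝ → ℝ → ℂ := fun σ τ x =>
    G (i.insertNth ((x : ℂ) + ((τ * σ : ℝ) : ℂ) * I) fun j => (((q j).re : ℝ) : ℂ) + ((τ * (q j).im : ℝ) : ℂ) * I) with hF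
  have hπ : (-π : ℝ) ≤ π := by linarith [Real.pi_pos]
  have hp : |w i| = w i := abs_of_nonneg hwi
  have hm : |-(w i)| = w i := by rw [abs_neg, hp]
  have h0 : (0 : ℝ) ∈ Icc (0 : ℝ) 1 := ⟨le_rfl, zero_le_one⟩
  have h1 : (1 : ℝ) ∈ Icc (0 : ℝ) 1 := ⟨zero_le_one, le_rfl⟩
  have hFc : ∀ σ : ℝ, |σ| = w i → ContinuousOn (fun p : ℝ × ℝ => F σ p.1 p.2) (Icc 0 1 ×ˢ Icc (-π) π) :=
    fun σ hσ => h.continuousOn_finFamily i hq hσ.le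
  have hFz : ∀ σ : ℝ, |σ| = w i → ∀ τ ∈ Icc (0 : ℝ) 1, ∀ x ∈ Icc (-π) π, F σ τ x ≠ 0 := fun σ hσ => hfin σ hσ
  have hFe : ∀ σ : ℝ, ∀ τ ∈ Icc (0 : ℝ) 1, F σ τ π = F σ τ (-π) := fun σ τ _ => h.finFamily_closed i q σ τ
  have hc : ∀ σ : ℝ, |σ| = w i → ∀ τ ∈ Icc (0 : ℝ) 1, ContinuousOn (F σ τ) (Icc (-π) π) := fun σ hσ τ hτ =>
    (hFc σ hσ).comp (Continuous.prodMk_right τ).continuousOn fun x hx => ⟨hτ, hx⟩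
  -- the real loop at `τ = 0` does not depend on the slope
  have hF0 : ∀ x, F (-(w i)) 0 x = F (w i) 0 x := fun x => by simp [hF]
  -- logarithms of the three loops
  obtain ⟨L₀, hL₀⟩ := exists_isContLog (hc (w i) hp 0 h0) fun x hx => hFz (w i) hp 0 h0 x hx
  obtain ⟨Lp, hLp⟩ := exists_isContLog (hc (w i) hp 1 h1) fun x hx => hFz (w i) hp 1 h1 x hx
  obtain ⟨Lm, hLm⟩ := exists_isContLog (hc (-(w i)) hm 1 h1) fun x hx => hFz (-(w i)) hm 1 h1 x hx
  have hL₀' : IsContLog (F (-(w i)) 0) (-π) π L₀ := hL₀.congr fun x _ => hF0 x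
  have ep : Lp π - Lp (-π) = L₀ π - L₀ (-π) :=
    incr_eq_of_family (F := F (w i)) hπ (hFc (w i) hp) (hFz (w i) hp) (hFe (w i)) h1 h0 hLp hL₀
  have em : Lm π - Lm (-π) = L₀ π - L₀ (-π) :=
    incr_eq_of_family (F := F (-(w i))) hπ (hFc (-(w i)) hm) (hFz (-(w i)) hm) (hFe (-(w i))) h1 h0 hLm hL₀'
  -- at `τ = 1` the families are the two edge functions of the slice
  have e1 : ∀ σ x, F σ 1 x = hEdge (slice G i q) σ x := fun σ x => by
    simp only [hF, hEdge_apply, slice_apply, one_mul]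
    rw [shrink_one q]
  refine ⟨Lp, Lm, hLp.congr fun x _ => (e1 (w i) x).symm, hLm.congr fun x _ => (e1 (-(w i)) x).symm, by rw [ep, em]⟩

/-! ## §3 THEOREM DB with (W) := fins -/

/-- the fin points through a PURELY IMAGINARY reference parameter `i·c`: `Re q + iτ·Im q = iτ·c`. [folklore] -/
theorem shrink_pureIm (c : Fin d → ℝ) (τ : ℝ) :
    (fun j => (((((c j : ℝ) : ℂ) * I).re : ℝ) : ℂ) + ((τ * (((c j : ℝ) : ℂ) * I).im : ℝ) : ℂ) * I) = fun j => ((τ * c j : ℝ) : ℂ) * I := by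
  funext j; simp

/-- **THE (W) HYPOTHESIS OF THEOREM DB FROM FINS** (general sign patterns): for a tube-holomorphic `G` (all `w_μ ≥ 0`) with no zero on the fins
`{x·e_i + iτσ·e_i + iτ·(s∘w)' : x ∈ [−π, π], τ ∈ [0, 1]}` for every coordinate `i`, every sign pattern `s ∈ {±1}^d` of the other coordinates and
both slopes `σ = ±w_i`, the (W) hypothesis of `TubeHol.ne_zero_of_vertexTori` ∕ `MatTubeHol.det_ne_zero_of_vertexTori` ∕
`CapRouteABoxes.rowsOfOneLoopFormCode16E_routeA₂_ofBoxesRealShift` holds AS DATA, at the purely imaginary reference parameters `i·s∘w`. [folklore] -/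
theorem windingHyp_of_fins (h : TubeHol G w) (hw : ∀ μ, 0 ≤ w μ)
    (hfin : ∀ (i : Fin (d + 1)) (s : Fin d → ℝ), (∀ j, s j = 1 ∨ s j = -1) → ∀ σ : ℝ, |σ| = w i →
      ∀ τ ∈ Icc (0 : ℝ) 1, ∀ x ∈ Icc (-π) π,
        G (i.insertNth ((x : ℂ) + ((τ * σ : ℝ) : ℂ) * I) fun j => ((τ * (s j * w (i.succAbove j)) : ℝ) : ℂ) * I) ≠ 0) :
    ∀ (i : Fin (d + 1)) (s : Fin d → ℝ), (∀ j, s j = 1 ∨ s j = -1) →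
      ∃ q₀ : Fin d → ℂ, (∀ j, (q₀ j).im = s j * w (i.succAbove j)) ∧ SliceWindingEq G w i q₀ := by
  intro i s hs
  refine ⟨fun j => ((s j * w (i.succAbove j) : ℝ) : ℂ) * I, fun j => by simp, ?_⟩
  refine SliceWindingEq.of_fins h i (hw i) (fun j => ?_) fun σ hσ τ hτ x hx => ?_
  · have him : ((((s j * w (i.succAbove j) : ℝ) : ℂ) * I)).im = s j * w (i.succAbove j) := by simp
    rw [him, abs_mul]
    rcases hs j with e | e <;> rw [e] <;> simp [abs_of_nonneg (hw (i.succAbove j))]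
  · rw [shrink_pureIm]; exact hfin i s hs σ hσ τ hτ x hx

/-- **THEOREM DB WITH FINS.**  A tube-holomorphic multiplier `G` (all `w_μ > 0`) with (F) no zero on the VERTEX TORI and no zero on the
`(d+1)·2^{d+1}` FINS `{x·e_i + iτσ·e_i + iτ·(s∘w)' : x ∈ [−π, π], τ ∈ [0, 1]}` (`i` a coordinate, `s ∈ {±1}^d`, `σ = ±w_i`; 2 real dimensions
each) has NO ZERO on the closed tube — THEOREM DB with its winding data replaced by zero-freeness data of the box-leaf type. [folklore] -/
theorem TubeHol.ne_zero_of_vertexTori_of_fins (h : TubeHol G w) (hw : ∀ μ, 0 < w μ) (hF : ∀ p ∈ VertexTori w, G p ≠ 0)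
    (hfin : ∀ (i : Fin (d + 1)) (s : Fin d → ℝ), (∀ j, s j = 1 ∨ s j = -1) → ∀ σ : ℝ, |σ| = w i →
      ∀ τ ∈ Icc (0 : ℝ) 1, ∀ x ∈ Icc (-π) π,
        G (i.insertNth ((x : ℂ) + ((τ * σ : ℝ) : ℂ) * I) fun j => ((τ * (s j * w (i.succAbove j)) : ℝ) : ℂ) * I) ≠ 0) :
    ∀ p ∈ Tube w, G p ≠ 0 :=
  h.ne_zero_of_vertexTori hw hF (windingHyp_of_fins h (fun μ => (hw μ).le) hfin)

/-- the same conclusion read on the period cell `Strip (d+1) a` for equal half-widths. [folklore] -/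
theorem TubeHol.ne_zero_strip_of_vertexTori_of_fins {a : ℝ} (h : TubeHol G (fun _ => a)) (ha : 0 < a)
    (hF : ∀ p ∈ VertexTori (fun _ : Fin (d + 1) => a), G p ≠ 0)
    (hfin : ∀ (i : Fin (d + 1)) (s : Fin d → ℝ), (∀ j, s j = 1 ∨ s j = -1) → ∀ σ : ℝ, |σ| = a →
      ∀ τ ∈ Icc (0 : ℝ) 1, ∀ x ∈ Icc (-π) π,
        G (i.insertNth ((x : ℂ) + ((τ * σ : ℝ) : ℂ) * I) fun j => ((τ * (s j * a) : ℝ) : ℂ) * I) ≠ 0) :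
    ∀ p ∈ Strip (d + 1) a, G p ≠ 0 :=
  fun p hp => h.ne_zero_of_vertexTori_of_fins (fun _ => ha) hF hfin p fun μ => (hp μ).2

/-- **THE (Z1) BINDER FROM VERTEX-TORI DATA AND FINS**: for a tube-holomorphic matrix family `A` (`MatTubeHol A (fun _ => a)`, `0 < a`),
(F) `det (A q) ≠ 0` on the `2^{d+1}` vertex tori and `det (A q) ≠ 0` on the `(d+1)·2^{d+1}` fins give EXACTLY the hypothesis
`hdet : ∀ p ∈ Strip (d+1) a, (A p).det ≠ 0` of `CapRouteA.rowsOfOneLoopFormCode16E_routeA₂` ∕ `TubeHolAlgebra.tubeHol_oneLoopForm` — both inputs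
are box-leaf conclusions `IsUnit (A q).det` (`ResolventBoxCertificate` on the tori, `ResolventFinCertificate` on the fins). [folklore] -/
theorem MatTubeHol.det_ne_zero_of_vertexTori_of_fins {n : Type*} [Fintype n] [DecidableEq n]
    {A : (Fin (d + 1) → ℂ) → Matrix n n ℂ} {a : ℝ} (hA : MatTubeHol A (fun _ => a)) (ha : 0 < a)
    (hF : ∀ p ∈ VertexTori (fun _ : Fin (d + 1) => a), (A p).det ≠ 0)
    (hfin : ∀ (i : Fin (d + 1)) (s : Fin d → ℝ), (∀ j, s j = 1 ∨ s j = -1) → ∀ σ : ℝ, |σ| = a →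
      ∀ τ ∈ Icc (0 : ℝ) 1, ∀ x ∈ Icc (-π) π,
        (A (i.insertNth ((x : ℂ) + ((τ * σ : ℝ) : ℂ) * I) fun j => ((τ * (s j * a) : ℝ) : ℂ) * I)).det ≠ 0) :
    ∀ p ∈ Strip (d + 1) a, (A p).det ≠ 0 :=
  hA.det.ne_zero_strip_of_vertexTori_of_fins ha hF hfin

/-! ## §4 Reflection-invariant multipliers: `d + 1` all-plus fins -/

/-- reflecting the full vector in the direction `i` = negating the inserted coordinate. [folklore] -/
theorem reflectAt_insertNth_same (i : Fin (d + 1)) (z : ℂ) (q : Fin d → ℂ) :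
    reflectAt i (i.insertNth z q) = i.insertNth (-z) q := by
  funext μ
  refine Fin.succAboveCases i ?_ ?_ μ
  · rw [reflectAt_apply_same, Fin.insertNth_apply_same, Fin.insertNth_apply_same]
  · intro k
    rw [reflectAt_apply_ne (Fin.succAbove_ne i k), Fin.insertNth_apply_succAbove, Fin.insertNth_apply_succAbove]

/-- under the reflection `q_i ↦ −q_i` leaving `G` invariant, the fin point of slope `−σ` at `x` carries the value of the fin point of slope
`σ` at `−x`. [folklore] -/
theorem fin_neg_of_reflect {i : Fin (d + 1)} (hR : ∀ p, G (reflectAt i p) = G p) (q : Fin d → ℂ) (σ τ x : ℝ) :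
    G (i.insertNth ((x : ℂ) + ((τ * -σ : ℝ) : ℂ) * I) q) = G (i.insertNth (((-x : ℝ) : ℂ) + ((τ * σ : ℝ) : ℂ) * I) q) := by
  rw [← hR (i.insertNth (((-x : ℝ) : ℂ) + ((τ * σ : ℝ) : ℂ) * I) q), reflectAt_insertNth_same]
  congr 2
  push_cast; ring

/-- **THE ALL-PLUS (W) DATUM FROM ONE FIN**: for a tube-holomorphic `G` invariant under `q_i ↦ −q_i` (all `w_μ ≥ 0`), zero-freeness on the
ALL-PLUS fin `{x·e_i + iτ·w : x ∈ [−π, π], τ ∈ [0, 1]}` gives `SliceWindingEq G w i (i·w')` — EXACTLY the hypothesis `hW4 i` of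
`CapRouteABoxesReflect.rowsOfOneLoopFormCode16E_routeA₂_ofBoxesRealShift_ofReflect` (there `w = fun _ => κ`), AS DATA. [folklore] -/
theorem sliceWindingEq_allPlus_of_fin (h : TubeHol G w) (i : Fin (d + 1)) (hw : ∀ μ, 0 ≤ w μ)
    (hR : ∀ p, G (reflectAt i p) = G p)
    (hfin : ∀ τ ∈ Icc (0 : ℝ) 1, ∀ x ∈ Icc (-π) π,
      G (i.insertNth ((x : ℂ) + ((τ * w i : ℝ) : ℂ) * I) fun j => ((τ * w (i.succAbove j) : ℝ) : ℂ) * I) ≠ 0) :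
    SliceWindingEq G w i fun j => ((w (i.succAbove j) : ℝ) : ℂ) * I := by
  have hq : (fun j => ((w (i.succAbove j) : ℝ) : ℂ) * I) ∈ Tube (fun j => w (i.succAbove j)) := fun j => by
    simp [abs_of_nonneg (hw (i.succAbove j))]
  refine SliceWindingEq.of_fins h i (hw i) hq fun σ hσ τ hτ x hx => ?_
  rw [shrink_pureIm]
  rcases (abs_eq (hw i)).mp hσ with e | e
  · rw [e]; exact hfin τ hτ x hx
  · rw [e, fin_neg_of_reflect hR]
    exact hfin τ hτ (-x) ⟨by linarith [hx.2], by linarith [hx.1]⟩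

/-- **THEOREM DB FOR A REFLECTION-INVARIANT MULTIPLIER, WITH FINS**: `G (reflectAt ν p) = G p` for every coordinate `ν`, (F) no zero on the
vertex tori, and no zero on the `d + 1` ALL-PLUS FINS `{x·e_i + iτ·w : x ∈ [−π, π], τ ∈ [0, 1]}` ⟹ no zero on the closed tube (for the cell's
`det k₀`: FOUR fin rectangles `[−π, π] × [0, 1]` replace the eight closed compass words of census V22). [folklore] -/
theorem TubeHol.ne_zero_of_vertexTori_of_reflect_of_fins (h : TubeHol G w) (hw : ∀ μ, 0 < w μ)
    (hF : ∀ p ∈ VertexTori w, G p ≠ 0) (hR : ∀ ν p, G (reflectAt ν p) = G p)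
    (hfin : ∀ (i : Fin (d + 1)), ∀ τ ∈ Icc (0 : ℝ) 1, ∀ x ∈ Icc (-π) π,
      G (i.insertNth ((x : ℂ) + ((τ * w i : ℝ) : ℂ) * I) fun j => ((τ * w (i.succAbove j) : ℝ) : ℂ) * I) ≠ 0) :
    ∀ p ∈ Tube w, G p ≠ 0 :=
  h.ne_zero_of_vertexTori_of_reflect hw hF hR fun i =>
    sliceWindingEq_allPlus_of_fin h i (fun μ => (hw μ).le) (hR i) (hfin i)

/-- the same read on the period cell `Strip (d+1) a`, for a matrix family: the (Z1) binder `hdet` from (F) + reflection invariance of `det ∘ A`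
+ `d + 1` all-plus fins. [folklore] -/
theorem MatTubeHol.det_ne_zero_of_vertexTori_of_reflect_of_fins {n : Type*} [Fintype n] [DecidableEq n]
    {A : (Fin (d + 1) → ℂ) → Matrix n n ℂ} {a : ℝ} (hA : MatTubeHol A (fun _ => a)) (ha : 0 < a)
    (hF : ∀ p ∈ VertexTori (fun _ : Fin (d + 1) => a), (A p).det ≠ 0)
    (hR : ∀ (ν : Fin (d + 1)) (p : Fin (d + 1) → ℂ), (A (reflectAt ν p)).det = (A p).det)
    (hfin : ∀ (i : Fin (d + 1)), ∀ τ ∈ Icc (0 : ℝ) 1, ∀ x ∈ Icc (-π) π,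
      (A (i.insertNth ((x : ℂ) + ((τ * a : ℝ) : ℂ) * I) fun _ => ((τ * a : ℝ) : ℂ) * I)).det ≠ 0) :
    ∀ p ∈ Strip (d + 1) a, (A p).det ≠ 0 :=
  fun p hp => hA.det.ne_zero_of_vertexTori_of_reflect_of_fins (fun _ => ha) hF hR hfin p fun μ => (hp μ).2

end

end Summit.QuantumFields.BalabanUV.Beta.TubeMaximumModulus
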